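import Summits.RiemannHypothesis.RiemannHypothesis.Theorems.GroundBartaEvenWinsBeyondArchPhantomCertificate
import HarnessLib

/-!
# RiemannHypothesis / GroundBarta machinery — PHANTOM CERTIFICATES (3/3): soundness of `WeilCert23X`

Helper file (`--supports stmt-RiemannHypothesis-18085`), RH-free, axioms standard.  Seat rh-explicit-weil-1.  Verbatim adaptation of
`WeilCert23.freq_integral_bound` / `margin_step3` / `weilTwoPrimeQuadratic_nonneg_of_check` (`WeilTwoPrimeCertificate.lean`) to the phantom
format: minorant `γ_X` (`…PhantomCertGamma.lean`), boosted level `wL`, Step B through the phantom identity (`WeilCert23X.arch_lower_bound`),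
tail level of `w₂₃ + P` beyond `T` as the hypothesis `hlevel`.  Main result **`WeilCert23X.weilTwoPrimeQuadratic_nonneg_of_check`** /
`_of_parts` (`0 ≤ E₂₃(g)` on `C(b)`).  Everything here is proved; no named facts.
-/

set_option linter.dupNamespace false

noncomputable section

open Complex Finset MeasureTheory Set Filter
open scoped Real Topology ComplexConjugate BigOperators

namespace Summit.RiemannHypothesis.RiemannHypothesis.Theorems.EvenWinsBeyondArch

open Literature.NumberTheory.LFunctions
open Literature.Analysis.ValidatedNumerics.Numerics
open Literature.Analysis.SpecialFunctions

namespace WeilCert23X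

variable {c : WeilCert23X} {g : ℝ → ℂ}

/-- **Frequency bound (signed minorant).** `∫ ‖ĝ(1/2+it)‖² γ_X(t) dt ≤ Σ Ĝ_{kl} Re(conj M_k M_l) + 5 ‖g‖₁² ν'_abs`. [folklore] -/
theorem freq_integral_bound (h23 : CellsOK₂₃ c.base.wL c.base.T c.cells) (hX : XCellsOK c.rs c.base.T c.xcells)
    (hsc : c.checkScalars = true) (hg : IsWeilTest g) (hsupp : tsupport g ⊆ Icc (-(c.base.a0 : ℝ)) c.base.a0) :
    ∫ t : ℝ, ‖weilMellin g (1 / 2 + t * I)‖ ^ 2 * gammaX c.base.wL c.wL c.base.T c.cells c.xcells t ≤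
      ∑ k ∈ range (c.base.N + 1), ∑ l ∈ range (c.base.N + 1),
          gHat c k l * (conj (weilMoment c.base.a0 g k) * weilMoment c.base.a0 g l).re +
        5 * weilNorm1 g ^ 2 * ((c.nuPrimeAbs : ℚ) : ℝ) := by
  obtain ⟨hb0, -, hba, ha1, hT, haT, hρT, hN, -⟩ := scalarsX_spec hsc
  set a : ℝ := (c.base.a0 : ℝ) with ha_def
  have ha : 0 < a := by
    have h1 : (0 : ℝ) < c.b := by exact_mod_cast hb0
    have h2 : ((c.b : ℚ) : ℝ) ≤ c.base.a0 := by exact_mod_cast hba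
    rw [ha_def]; linarith
  set γ : ℝ → ℝ := gammaX c.base.wL c.wL c.base.T c.cells c.xcells with hγ
  set M : ℕ → ℂ := weilMoment a g with hM
  set n := c.base.N + 1 with hn
  set L := weilNorm1 g with hL
  have hn_even : Even n := ⟨c.base.nb, by omega⟩
  set W : ℕ → ℕ → ℝ := fun k l ↦ (((-1 : ℂ) ^ k * I ^ (k + l)) * (conj (M k) * M l)).re with hW
  have hpt : ∀ t : ℝ, ‖weilMellin g (1 / 2 + t * I)‖ ^ 2 * γ t ≤
      (∑ k ∈ range n, ∑ l ∈ range n,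
        W k l * (a ^ (k + l) / (k.factorial * l.factorial)) * (γ t * t ^ (k + l))) +
        5 * L ^ 2 * (2 * a ^ n / n.factorial) * (|γ t| * t ^ n) := by
    intro t
    rcases lt_or_ge |t| (c.base.T : ℝ) with ht | ht
    · have ht1 : 2 * a * |t| ≤ c.base.N + 2 := by
        have h1 : 2 * a * |t| ≤ 2 * a * c.base.T := by nlinarith
        have h2 : (2 * c.base.a0 * c.base.T : ℝ) ≤ c.base.N + 2 := by exact_mod_cast haT
        rw [ha_def] at h1 ⊢; linarith
      have ht2 : 2 * (|t| * a) ^ (c.base.N + 1) / (c.base.N + 1).factorial ≤ 1 := by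
        have h1 : (|t| * a) ^ (c.base.N + 1) ≤ (c.base.T * a) ^ (c.base.N + 1) :=
          pow_le_pow_left₀ (by positivity) (by nlinarith) _
        have h2 : (2 * (c.base.a0 * c.base.T) ^ (c.base.N + 1) / (c.base.N + 1).factorial : ℝ) ≤ 1 := by
          exact_mod_cast hρT
        rw [ha_def] at h1 ⊢
        rw [mul_comm (c.base.a0 : ℝ)] at h2
        have h3 : 2 * (|t| * ↑c.base.a0) ^ (c.base.N + 1) / ((c.base.N + 1).factorial : ℝ) ≤
            2 * (↑c.base.T * ↑c.base.a0) ^ (c.base.N + 1) / ((c.base.N + 1).factorial : ℝ) := by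
          gcongr
        linarith
      have h := WeilCert2.freq_pointwise_bound_abs hg ha hsupp c.base.N ht1 ht2
      set S : ℝ := ∑ k ∈ range (c.base.N + 1), ∑ l ∈ range (c.base.N + 1),
          (((-1 : ℂ) ^ k * I ^ (k + l)) * (conj (M k) * M l)).re *
            ((t * a) ^ (k + l) / (k.factorial * l.factorial)) with hS
      set R : ℝ := 5 * (2 * (|t| * a) ^ (c.base.N + 1) / (c.base.N + 1).factorial) * L ^ 2 with hR
      have hR0 : 0 ≤ R := by rw [hR]; positivity
      have hdiff : |‖weilMellin g (1 / 2 + t * I)‖ ^ 2 - S| ≤ R := by rw [hS, hR, hM]; exact h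
      have hkey : ‖weilMellin g (1 / 2 + t * I)‖ ^ 2 * γ t ≤ S * γ t + R * |γ t| := by
        have e : ‖weilMellin g (1 / 2 + t * I)‖ ^ 2 * γ t =
            S * γ t + (‖weilMellin g (1 / 2 + t * I)‖ ^ 2 - S) * γ t := by ring
        rw [e]
        have := abs_mul (‖weilMellin g (1 / 2 + t * I)‖ ^ 2 - S) (γ t)
        have h2 : |‖weilMellin g (1 / 2 + t * I)‖ ^ 2 - S| * |γ t| ≤ R * |γ t| :=
          mul_le_mul_of_nonneg_right hdiff (abs_nonneg _)
        linarith [le_abs_self ((‖weilMellin g (1 / 2 + t * I)‖ ^ 2 - S) * γ t)]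
      refine hkey.trans (le_of_eq ?_)
      congr 1
      · rw [hS, Finset.sum_mul, ← hn]
        refine Finset.sum_congr rfl fun k _ ↦ ?_
        rw [Finset.sum_mul]
        refine Finset.sum_congr rfl fun l _ ↦ ?_
        rw [hW, mul_pow]
        simp only
        ring
      · rw [hR, ← hn_even.pow_abs t, hn, mul_pow]
        ring
    · have h0 : γ t = 0 := gammaX_eq_zero h23 hX ht
      rw [h0]
      simp
  obtain ⟨B, hB0, hB⟩ := exists_abs_gammaX_le (wL := c.wL) h23 hX
  have hiL : Integrable fun t : ℝ ↦ ‖weilMellin g (1 / 2 + t * I)‖ ^ 2 * γ t :=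
    integrable_norm_sq_weilMellin_mul hg (measurable_gammaX _ _ _ _ _) hB0 le_rfl (B := 0)
      (fun t ↦ by simpa using hB t)
  have hiq : ∀ q, Integrable fun t ↦ γ t * t ^ q := fun q ↦ (integral_gammaX_pow h23 hX q).1
  obtain ⟨hiabs, habsle⟩ := integral_abs_gammaX_mul_pow_le (wL := c.wL) h23 hX hn_even
  have hiR : Integrable fun t ↦ (∑ k ∈ range n, ∑ l ∈ range n,
      W k l * (a ^ (k + l) / (k.factorial * l.factorial)) * (γ t * t ^ (k + l))) +
      5 * L ^ 2 * (2 * a ^ n / n.factorial) * (|γ t| * t ^ n) := by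
    refine Integrable.add (integrable_finsetSum _ fun k _ ↦ integrable_finsetSum _ fun l _ ↦
      (hiq (k + l)).const_mul _) (hiabs.const_mul _)
  have hint := integral_mono hiL hiR hpt
  refine hint.trans ?_
  rw [integral_add (integrable_finsetSum _ fun k _ ↦ integrable_finsetSum _ fun l _ ↦
      (hiq (k + l)).const_mul _) (hiabs.const_mul _),
    integral_finsetSum _ fun k _ ↦ integrable_finsetSum _ fun l _ ↦ (hiq (k + l)).const_mul _]
  refine add_le_add (le_of_eq ?_) ?_
  · refine Finset.sum_congr rfl fun k _ ↦ ?_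
    rw [integral_finsetSum _ fun l _ ↦ (hiq (k + l)).const_mul _]
    refine Finset.sum_congr rfl fun l _ ↦ ?_
    rw [integral_const_mul, (integral_gammaX_pow h23 hX (k + l)).2, gHat]
    by_cases hkl : k % 2 = l % 2
    · have hev : Even (k + l) := (WeilCert.mod_two_eq_iff_even k l).1 hkl
      rw [if_pos hkl, if_pos hev, hW]
      simp only
      rw [WeilAna.I_pow_even hev,
        show ((-1 : ℂ) ^ k * (-1) ^ ((k + l) / 2)) * (conj (M k) * M l) =
          (((-1 : ℝ) ^ k * (-1) ^ ((k + l) / 2) : ℝ) : ℂ) * (conj (M k) * M l) by push_cast; ring,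
        Complex.re_ofReal_mul]
      unfold nuQ
      push_cast
      rw [hM, ha_def]
      ring
    · have hodd : ¬ Even (k + l) := fun h ↦ hkl ((WeilCert.mod_two_eq_iff_even k l).2 h)
      rw [if_neg hkl, if_neg hodd]
      simp
  · rw [integral_const_mul]
    have hfac : 0 ≤ 5 * L ^ 2 * (2 * a ^ n / n.factorial) := by positivity
    have := mul_le_mul_of_nonneg_left habsle hfac
    refine this.trans (le_of_eq ?_)
    unfold nuPrimeAbs
    push_cast
    rw [hn, ha_def]
    ring

set_option maxHeartbeats 1600000 in
/-- **The analytic reduction of the phantom certificate** (valid for every test function): if the cell chains, scalar and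
moment checks pass, the phantom is admissible on `C(b)` and the boosted level holds for `w₂₃ + P` beyond `T`, then
`Σ_{k,l ≤ N} P_r(k,l) Re(conj M_k M_l) + κ ‖g‖₂² ≤ E₂₃(g)` on `C(b)`. [folklore] -/
theorem margin_step3 (h23 : CellsOK₂₃ c.base.wL c.base.T c.cells) (hX : XCellsOK c.rs c.base.T c.xcells)
    (hadm : ∀ r ∈ c.rs, 2 * (c.b : ℝ) ≤ |rippleFreq r|)
    (hlevel : ∀ t : ℝ, (c.base.T : ℝ) ≤ |t| → (c.wL : ℝ) ≤ weilTwoPrimeWeight t + ripplesVal c.rs t)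
    (hsc : c.checkScalars = true) (hnuchk : c.checkNu = true) (hg : IsWeilTest g)
    (hsupp : tsupport g ⊆ Icc (-(c.b : ℝ)) c.b) :
    ∑ k ∈ range (c.base.N + 1), ∑ l ∈ range (c.base.N + 1),
        ((c.base.prQ c.nuTab k l : ℚ) : ℝ) * (conj (weilMoment c.base.a0 g k) * weilMoment c.base.a0 g l).re +
      ((c.kappaQ : ℚ) : ℝ) * weilNorm2Sq g ≤ weilTwoPrimeQuadratic g := by
  unfold weilTwoPrimeQuadratic
  obtain ⟨hbpos, -, hba, ha1q, -, -, -, hN, -⟩ := scalarsX_spec hsc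
  set a : ℝ := (c.base.a0 : ℝ) with ha_def
  have hba' : ((c.b : ℚ) : ℝ) ≤ a := by rw [ha_def]; exact_mod_cast hba
  have hb0' : (0 : ℝ) < c.b := by exact_mod_cast hbpos
  have ha : 0 < a := by linarith
  have ha1 : a ≤ 1 := by rw [ha_def]; exact_mod_cast ha1q
  have hsupp' : tsupport g ⊆ Icc (-a) a := hsupp.trans (Icc_subset_Icc (by linarith) hba')
  set n := c.base.N + 1 with hn
  set nu := c.nuTab with hnu
  set M : ℕ → ℂ := weilMoment a g with hM
  set L := weilNorm1 g with hL
  set N2 := weilNorm2Sq g with hN2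
  set z : ℕ → ℕ → ℝ := fun k l ↦ (conj (M k) * M l).re with hz
  have hzsym : ∀ k l, z k l = z l k := fun k l ↦ by
    rw [hz]; simp only; rw [← WeilAna.re_mul_conj_eq, mul_comm]
  have hL0 : 0 ≤ L := weilNorm1_nonneg g
  have hN20 : 0 ≤ N2 := weilNorm2Sq_nonneg g
  have hL1 : L ^ 2 ≤ 2 * a * N2 := weilNorm1_sq_le hg ha hsupp'
  set P : ℝ := 2 * (weilMellin g 0 * conj (weilMellin g 1)).re with hP
  set A : ℝ := ∫ t : ℝ, ‖weilMellin g (1 / 2 + t * I)‖ ^ 2 * weilTwoPrimeWeight t with hA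
  set γX : ℝ → ℝ := gammaX c.base.wL c.wL c.base.T c.cells c.xcells with hγX
  set Γ : ℝ := ∫ t : ℝ, ‖weilMellin g (1 / 2 + t * I)‖ ^ 2 * γX t with hΓ
  set ρ : ℝ := 2 * (a / 2) ^ (c.base.N + 1) / (c.base.N + 1).factorial with hρ
  have hρ0 : 0 ≤ ρ := by positivity
  have hPA : ∑ k ∈ range n, ∑ l ∈ range n,
      (2 * ((-a / 2) ^ k / k.factorial) * ((a / 2) ^ l / l.factorial)) * z k l -
      (8 * ρ + 6 * ρ ^ 2) * L ^ 2 ≤ P := WeilAna.polar_lower_bound hg ha ha1 hsupp' c.base.N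
  rw [WeilCert.polar_symmetrize n a z hzsym] at hPA
  -- Step B
  have hB : (c.wL : ℝ) * (2 * π * N2) - Γ ≤ A := arch_lower_bound h23 hX hadm hlevel hg hsupp
  -- Step C
  have hC : Γ ≤ ∑ k ∈ range n, ∑ l ∈ range n, gHat c k l * z k l + 5 * L ^ 2 * (c.nuPrimeAbs : ℝ) := by
    have := freq_integral_bound h23 hX hsc hg (by rwa [← ha_def])
    rw [← ha_def] at this
    exact this
  set q : ℝ := ((invTwoPiHi20 : ℚ) : ℝ) with hq
  set qLo : ℝ := ((invTwoPiLo20 : ℚ) : ℝ) with hqLo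
  have hq1 : 1 / (2 * π) ≤ q := invTwoPiHi20_ge
  have hq0 : 0 ≤ q := invTwoPiHi20_nonneg
  have hqLo1 : qLo ≤ 1 / (2 * π) := invTwoPiLo20_le
  have hlogpi : Real.log π ≤ ((logPiHi20 : ℚ) : ℝ) := logPiHi20_ge
  have hν0 : 0 ≤ ((c.nuPrimeAbs : ℚ) : ℝ) := by
    unfold nuPrimeAbs
    have hev : Even (c.base.N + 1) := ⟨c.base.nb, by omega⟩
    have h1 := absMomentX_nonneg (wL := c.wL) h23 hX hev
    push_cast
    have ha0 : (0 : ℝ) ≤ (c.base.a0 : ℝ) := by rw [← ha_def]; exact ha.le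
    positivity
  have hpi : 0 < 1 / (2 * π) := by positivity
  set C₀ : ℝ := ((c.bnd : ℚ) : ℝ) with hC₀
  have hC₀0 : 0 ≤ C₀ := by rw [hC₀]; unfold bnd; exact_mod_cast bndX_nonneg _ _ _ _
  have hγabs : ∀ t, |γX t| ≤ C₀ := fun t ↦ by
    rw [hC₀, hγX]; unfold bnd; exact abs_gammaX_le h23 hX t
  set ind : ℝ → ℝ := Set.indicator (Icc (-(c.base.T : ℝ)) c.base.T) (fun _ ↦ (1 : ℝ)) with hind
  have hind01 : ∀ t, 0 ≤ ind t ∧ ind t ≤ 1 := fun t ↦ by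
    rw [hind]; by_cases ht : t ∈ Icc (-(c.base.T : ℝ)) c.base.T
    · rw [Set.indicator_of_mem ht]; norm_num
    · rw [Set.indicator_of_notMem ht]; norm_num
  have hindm : Measurable ind := by rw [hind]; exact measurable_const.indicator measurableSet_Icc
  set PiT : ℝ := ∫ t : ℝ, ‖weilMellin g (1 / 2 + t * I)‖ ^ 2 * ind t with hPiT
  have hiPiT : Integrable fun t : ℝ ↦ ‖weilMellin g (1 / 2 + t * I)‖ ^ 2 * ind t :=
    integrable_norm_sq_weilMellin_mul hg hindm (A := 1) (B := 0) zero_le_one le_rfl fun t ↦ by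
      rw [zero_mul, add_zero, abs_of_nonneg (hind01 t).1]; exact (hind01 t).2
  obtain ⟨BΓ, hBΓ0, hBΓ⟩ := exists_abs_gammaX_le (wL := c.wL) h23 hX
  have hiΓ : Integrable fun t : ℝ ↦ ‖weilMellin g (1 / 2 + t * I)‖ ^ 2 * γX t :=
    integrable_norm_sq_weilMellin_mul hg (measurable_gammaX _ _ _ _ _) hBΓ0 le_rfl (B := 0)
      (fun t ↦ by simpa using hBΓ t)
  have hPiT0 : 0 ≤ PiT := integral_nonneg fun t ↦ mul_nonneg (sq_nonneg _) (hind01 t).1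
  have hPiTle : PiT ≤ 7 * N2 := by
    have h1 : PiT ≤ ∫ t : ℝ, ‖weilMellin g (1 / 2 + t * I)‖ ^ 2 :=
      integral_mono hiPiT (integrable_norm_sq_weilMellin_half_line hg) fun t ↦ by
        simpa using mul_le_mul_of_nonneg_left (hind01 t).2 (sq_nonneg ‖weilMellin g (1 / 2 + t * I)‖)
    rw [integral_norm_sq_weilMellin_half_line hg] at h1
    have h7 : 2 * π ≤ 7 := by linarith [Real.pi_lt_d2]
    nlinarith
  have hΓplus : 0 ≤ Γ + C₀ * PiT := by
    rw [hΓ, hPiT, ← integral_const_mul, ← integral_add hiΓ (hiPiT.const_mul _)]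
    refine integral_nonneg fun t ↦ ?_
    rw [show ‖weilMellin g (1 / 2 + t * I)‖ ^ 2 * γX t + C₀ * (‖weilMellin g (1 / 2 + t * I)‖ ^ 2 * ind t) =
        ‖weilMellin g (1 / 2 + t * I)‖ ^ 2 * (γX t + C₀ * ind t) by ring]
    refine mul_nonneg (sq_nonneg _) ?_
    by_cases ht : t ∈ Icc (-(c.base.T : ℝ)) c.base.T
    · have : ind t = 1 := by rw [hind, Set.indicator_of_mem ht]
      rw [this, mul_one]
      linarith [neg_abs_le (γX t), hγabs t]
    · have : ind t = 0 := by rw [hind, Set.indicator_of_notMem ht]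
      have hT' : (c.base.T : ℝ) ≤ |t| := by
        rw [Set.mem_Icc, not_and_or, not_le, not_le] at ht
        rcases ht with ht | ht
        · linarith [neg_abs_le t, le_abs_self t, neg_le_abs t]
        · exact ht.le.trans (le_abs_self t)
      rw [this, mul_zero, add_zero, hγX, gammaX_eq_zero h23 hX hT']
  have hΓlow : -(q * (∑ k ∈ range n, ∑ l ∈ range n, gHat c k l * z k l +
      5 * L ^ 2 * (c.nuPrimeAbs : ℝ))) - (q - qLo) * C₀ * (7 * N2) ≤ -(1 / (2 * π) * Γ) := by
    have e : -(1 / (2 * π) * Γ) = -(1 / (2 * π)) * (Γ + C₀ * PiT) + 1 / (2 * π) * (C₀ * PiT) := by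
      ring
    rw [e]
    have h1 : -q * (Γ + C₀ * PiT) ≤ -(1 / (2 * π)) * (Γ + C₀ * PiT) := by nlinarith
    have h2 : qLo * (C₀ * PiT) ≤ 1 / (2 * π) * (C₀ * PiT) :=
      mul_le_mul_of_nonneg_right hqLo1 (mul_nonneg hC₀0 hPiT0)
    have h3 : q * Γ ≤ q * (∑ k ∈ range n, ∑ l ∈ range n, gHat c k l * z k l +
        5 * L ^ 2 * (c.nuPrimeAbs : ℝ)) := mul_le_mul_of_nonneg_left hC hq0
    have hqq : 0 ≤ q - qLo := by linarith [invTwoPiLo20_le_invTwoPiHi20]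
    have h4 : (q - qLo) * C₀ * PiT ≤ (q - qLo) * C₀ * (7 * N2) :=
      mul_le_mul_of_nonneg_left hPiTle (mul_nonneg hqq hC₀0)
    nlinarith
  have hB' : (c.wL : ℝ) * N2 - 1 / (2 * π) * Γ ≤ 1 / (2 * π) * A := by
    calc (c.wL : ℝ) * N2 - 1 / (2 * π) * Γ
        = 1 / (2 * π) * ((c.wL : ℝ) * (2 * π * N2) - Γ) := by field_simp
      _ ≤ 1 / (2 * π) * A := mul_le_mul_of_nonneg_left hB hpi.le
  have h5 : Real.log π * N2 ≤ ((logPiHi20 : ℚ) : ℝ) * N2 := mul_le_mul_of_nonneg_right hlogpi hN20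
  have step1 : ∑ k ∈ range n, ∑ l ∈ range n,
      ((if k % 2 = l % 2 then
        (-1 : ℝ) ^ k * 2 * ((a / 2) ^ k / k.factorial) * ((a / 2) ^ l / l.factorial) else 0) -
        q * gHat c k l) * z k l +
      ((c.wL : ℝ) - (logPiHi20 : ℚ) - 7 * (q - qLo) * C₀) * N2 -
      ((8 * ρ + 6 * ρ ^ 2) + 5 * q * (c.nuPrimeAbs : ℝ)) * L ^ 2 ≤
        P - Real.log π * N2 + 1 / (2 * π) * A := by
    have e1 : ∑ k ∈ range n, ∑ l ∈ range n,
        ((if k % 2 = l % 2 then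
          (-1 : ℝ) ^ k * 2 * ((a / 2) ^ k / k.factorial) * ((a / 2) ^ l / l.factorial) else 0) -
          q * gHat c k l) * z k l =
        ∑ k ∈ range n, ∑ l ∈ range n,
          (if k % 2 = l % 2 then
            (-1 : ℝ) ^ k * 2 * ((a / 2) ^ k / k.factorial) * ((a / 2) ^ l / l.factorial) else 0) *
              z k l -
        q * ∑ k ∈ range n, ∑ l ∈ range n, gHat c k l * z k l := by
      rw [Finset.mul_sum, ← Finset.sum_sub_distrib]
      refine Finset.sum_congr rfl fun k _ ↦ ?_
      rw [Finset.mul_sum, ← Finset.sum_sub_distrib]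
      refine Finset.sum_congr rfl fun l _ ↦ ?_
      ring
    rw [e1]
    linarith [hPA, hB', hΓlow, h5]
  have hMk : ∀ k, ‖M k‖ ≤ L := fun k ↦ norm_weilMoment_le hg ha hsupp' k
  set q6 : ℝ := ((invTwoPiHi : ℚ) : ℝ) with hq6
  have hq60 : 0 ≤ q6 := invTwoPiHi_nonneg
  set δ : ℝ := 1 / 2 ^ c.base.pg + q6 * (1 / 2 ^ c.pnu) with hδ
  have hδ0 : 0 ≤ δ := by rw [hδ]; positivity
  have hround : ∑ k ∈ range n, ∑ l ∈ range n, ((c.base.prQ nu k l : ℚ) : ℝ) * z k l -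
      ∑ k ∈ range n, ∑ l ∈ range n,
        ((if k % 2 = l % 2 then
          (-1 : ℝ) ^ k * 2 * ((a / 2) ^ k / k.factorial) * ((a / 2) ^ l / l.factorial) else 0) -
          q * gHat c k l) * z k l ≤ δ * (n : ℝ) ^ 2 * L ^ 2 := by
    refine WeilCert3.quad_rounding_le' n (fun k l ↦ ((c.base.prQ nu k l : ℚ) : ℝ)) _ δ L hδ0
      (fun k hk l hl ↦ ?_) M hMk
    have h1 : |((c.base.prQ nu k l : ℚ) : ℝ) - ((c.base.pmQ nu k l : ℚ) : ℝ)| ≤ 1 / 2 ^ c.base.pg := by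
      rw [abs_sub_comm]
      unfold WeilCert.prQ
      exact abs_cast_sub_ratRd_le c.base.pg (c.base.pmQ nu k l)
    have h2q := abs_pmQ_sub_pmQexactX_le hnuchk (by omega : l < c.base.N + 1) (by omega : k < c.base.N + 1)
    have h2 : |((c.base.pmQ nu k l : ℚ) : ℝ) - ((pmQexact c k l : ℚ) : ℝ)| ≤ q6 * (1 / 2 ^ c.pnu) := by
      have h := (Rat.cast_le (K := ℝ)).2 h2q
      rw [hnu, hq6]
      push_cast at h ⊢
      exact h
    have h3 : ((pmQexact c k l : ℚ) : ℝ) =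
        (if k % 2 = l % 2 then
          (-1 : ℝ) ^ k * 2 * ((a / 2) ^ k / k.factorial) * ((a / 2) ^ l / l.factorial) else 0) -
          q * gHat c k l := by
      rw [pmQexactX_cast, ha_def, hq]
      split_ifs <;> ring
    rw [hδ, ← h3]
    exact (abs_sub_le _ _ _).trans (add_le_add h1 h2)
  have hcoef : 0 ≤ (8 * ρ + 6 * ρ ^ 2) + 5 * q * (c.nuPrimeAbs : ℝ) + δ * (n : ℝ) ^ 2 :=
    add_nonneg (add_nonneg (by positivity) (mul_nonneg (mul_nonneg (by norm_num) hq0) hν0)) (by positivity)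
  have hkex : ((c.kappaExact : ℚ) : ℝ) =
      ((c.wL : ℝ) - (logPiHi20 : ℚ) - 7 * (q - qLo) * C₀) -
        2 * a * ((8 * ρ + 6 * ρ ^ 2) + 5 * q * (c.nuPrimeAbs : ℝ) + δ * (n : ℝ) ^ 2) := by
    rw [hρ, hq, hqLo, hC₀, hn, ha_def, hδ, hq6]
    unfold kappaExact WeilCert.etaP WeilCert.rhoE
    push_cast
    ring
  have hκle : ((c.kappaQ : ℚ) : ℝ) ≤ ((c.kappaExact : ℚ) : ℝ) := by
    unfold kappaQ; exact_mod_cast ratRd_le c.base.pg _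
  have h1 : ((c.kappaQ : ℚ) : ℝ) * N2 ≤ ((c.kappaExact : ℚ) : ℝ) * N2 := mul_le_mul_of_nonneg_right hκle hN20
  rw [hkex] at h1
  have h2 := mul_le_mul_of_nonneg_left hL1 hcoef
  linarith [step1, hround, h1, h2]

/-- **Soundness of the phantom certificate.** If `c.check = true` and the boosted level holds for `w₂₃ + P` beyond `T`
(`∀ |t| ≥ T, wL ≤ w₂₃(t) + P(t)`, `P = ripplesVal c.rs`), then the two-prime analytic form is non-negative on `C(b)`: for
every test function `g` with `tsupport g ⊆ [-b, b]`, `0 ≤ E₂₃(g)` (`= Re W(g ⋆ g̃)` for `b ≤ log 2`). [folklore] -/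
theorem weilTwoPrimeQuadratic_nonneg_of_check (h : c.check = true)
    (hlevel : ∀ t : ℝ, (c.base.T : ℝ) ≤ |t| → (c.wL : ℝ) ≤ weilTwoPrimeWeight t + ripplesVal c.rs t)
    (hg : IsWeilTest g) (hsupp : tsupport g ⊆ Icc (-(c.b : ℝ)) c.b) : 0 ≤ weilTwoPrimeQuadratic g := by
  obtain ⟨hcells3, hxc, hrip, hsc, hnuchk, hb0, hb1⟩ := checkX_spec h
  obtain ⟨hbpos, -, hba, -, hT, -, -, hN, hκ⟩ := scalarsX_spec hsc
  have h23 : CellsOK₂₃ c.base.wL c.base.T c.cells := cellsOK_of_checkCells₂₃ hcells3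
  have hX : XCellsOK c.rs c.base.T c.xcells := xCellsOK_of_checkXCells hxc
  have hadm := two_mul_b_le_abs_rippleFreq hX hT hrip
  have hb0' : (0 : ℝ) < c.b := by exact_mod_cast hbpos
  have hba' : ((c.b : ℚ) : ℝ) ≤ (c.base.a0 : ℝ) := by exact_mod_cast hba
  have ha : (0 : ℝ) < (c.base.a0 : ℝ) := by linarith
  have hsupp' : tsupport g ⊆ Icc (-(c.base.a0 : ℝ)) c.base.a0 := hsupp.trans (Icc_subset_Icc (by linarith) hba')
  have step3 := margin_step3 h23 hX hadm hlevel hsc hnuchk hg hsupp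
  have hbes := weilNorm2Sq_ge_bessel hg ha hsupp' (c.base.N + 1) (c.base.uVec (weilMoment c.base.a0 g))
  have hcore := WeilCert.core_nonnegK (c := c.base) (nu := c.nuTab) (κ := c.kappaQ) hN hb0 hb1 _ rfl
    (weilMoment c.base.a0 g)
  have hκ0 : (0 : ℝ) ≤ ((c.kappaQ : ℚ) : ℝ) := by exact_mod_cast hκ
  have h4 := mul_le_mul_of_nonneg_left hbes hκ0
  linarith


/-- **Soundness from parts** (for chains whose validity is a landed PROP, e.g. `cellsOK_weilTwoPrimeCellsT120`, and whose lattice-ripple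
chain / moment table are assembled from per-chunk kernel facts): the same conclusion from `CellsOK₂₃`, `XCellsOK` and the remaining
Boolean checks. [folklore] -/
theorem weilTwoPrimeQuadratic_nonneg_of_parts (h23 : CellsOK₂₃ c.base.wL c.base.T c.cells) (hX : XCellsOK c.rs c.base.T c.xcells)
    (hrip : c.checkRipples = true) (hsc : c.checkScalars = true) (hnuchk : c.checkNu = true)
    (hb0 : c.base.checkBlockK c.nuTab c.kappaQ 0 = true) (hb1 : c.base.checkBlockK c.nuTab c.kappaQ 1 = true)
    (hlevel : ∀ t : ℝ, (c.base.T : ℝ) ≤ |t| → (c.wL : ℝ) ≤ weilTwoPrimeWeight t + ripplesVal c.rs t)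
    (hg : IsWeilTest g) (hsupp : tsupport g ⊆ Icc (-(c.b : ℝ)) c.b) : 0 ≤ weilTwoPrimeQuadratic g := by
  obtain ⟨hbpos, -, hba, -, hT, -, -, hN, hκ⟩ := scalarsX_spec hsc
  have hadm := two_mul_b_le_abs_rippleFreq hX hT hrip
  have hb0' : (0 : ℝ) < c.b := by exact_mod_cast hbpos
  have hba' : ((c.b : ℚ) : ℝ) ≤ (c.base.a0 : ℝ) := by exact_mod_cast hba
  have ha : (0 : ℝ) < (c.base.a0 : ℝ) := by linarith
  have hsupp' : tsupport g ⊆ Icc (-(c.base.a0 : ℝ)) c.base.a0 := hsupp.trans (Icc_subset_Icc (by linarith) hba')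
  have step3 := margin_step3 h23 hX hadm hlevel hsc hnuchk hg hsupp
  have hbes := weilNorm2Sq_ge_bessel hg ha hsupp' (c.base.N + 1) (c.base.uVec (weilMoment c.base.a0 g))
  have hcore := WeilCert.core_nonnegK (c := c.base) (nu := c.nuTab) (κ := c.kappaQ) hN hb0 hb1 _ rfl
    (weilMoment c.base.a0 g)
  have hκ0 : (0 : ℝ) ≤ ((c.kappaQ : ℚ) : ℝ) := by exact_mod_cast hκ
  have h4 := mul_le_mul_of_nonneg_left hbes hκ0
  linarith

/-- **Soundness, Weil form.** Under the same hypotheses with `b ≤ log 2`: `0 ≤ Re W(g ⋆ g̃)` for every test function `g` with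
`tsupport g ⊆ [-b, b]`. [folklore] -/
theorem weilQuadratic_re_nonneg_of_check (h : c.check = true) (hb2 : (c.b : ℝ) ≤ Real.log 2)
    (hlevel : ∀ t : ℝ, (c.base.T : ℝ) ≤ |t| → (c.wL : ℝ) ≤ weilTwoPrimeWeight t + ripplesVal c.rs t)
    (hg : IsWeilTest g) (hsupp : tsupport g ⊆ Icc (-(c.b : ℝ)) c.b) : 0 ≤ (weilQuadratic g).re := by
  have hsupp2 : tsupport g ⊆ Icc (-Real.log 2) (Real.log 2) := hsupp.trans (Icc_subset_Icc (by linarith) hb2)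
  rw [weilQuadratic_re_eq_weilTwoPrimeQuadratic hg hsupp2]
  exact weilTwoPrimeQuadratic_nonneg_of_check h hlevel hg hsupp

end WeilCert23X

end Summit.RiemannHypothesis.RiemannHypothesis.Theorems.EvenWinsBeyondArch

end
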